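import Summits.Parity.GeneralizedHardyLittlewood.Theorems.PrimeLevelFamEdgeMomentsBeyondDiagonalDiagBoseMixedRemainderSqrt
import HarnessLib

/-!
# Route `PrimeLevelFamEdge`, crux K_A `MomentsBeyondDiagonal` (stmt-Parity-20007), line «petersson_layers» v4, stub `stub_diag`:
# **census R2 — the remainder IDENTITY `r_ab(y₁) − r_ab(y₂) = ∫_{y₁}^{y₂} ρ_ab/η` and the `(0,1]` interface for `r_ab` itself**

`…DiagBoseMixedStructure.bose_coeff_structure` exports the structure of `c_ab` as an inequality. The corner/Abel step needs the
variation of the continued remainder `r_ab(y) = c_ab(y) − c_ab(1) − A_ab − Π_ab(y)` itself; this file exports the underlying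
identity and the two `(0,1]` bounds for `r_ab` in the form consumed by `…DiagCornerAbelFinal.abs_doubleSum_sqrt_log_weight_le`:

* `bose_coeff_sub_polyPart_sub_eq` — **`(c_ab(y₁) − Π_ab(y₁)) − (c_ab(y₂) − Π_ab(y₂)) = ∫_{y₁<η≤y₂} ρ_ab(η)dη/η`**
  for `0 < y₁ ≤ y₂ ≤ 1` (shell identity + `shell_model_expand` + `integral_log_inv_pow_div`);
* `abs_bose_rem_small_le_sqrt` — **`|r_ab(y)| ≤ C√y`** for `0 < y ≤ 1`;
* `abs_bose_rem_small_sub_le_sqrt` — **`|r_ab(y₁) − r_ab(y₂)| ≤ C(y₂−y₁)/√y₁`** for `0 < y₁ ≤ y₂ ≤ 1`.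

Def-free; theorems only. Helper `--supports stmt-Parity-20007`; closes nothing; K_A, K_B and the Parity summit are NOT
proved; nothing about Landau–Siegel zeros.

## References
* E. Kowalski, P. Michel, J. VanderKam, J. reine angew. Math. 526 (2000), (22)–(28) pp. 12–15 and Prop. 5.1 p. 18.
  [cite: KowalskiMichelVanderKam2000, (22)–(28) — derivation (remainder of the diagonal weight, real-variable form)]
-/

noncomputable section

open Real Set MeasureTheory Filter Function Finset

namespace Summit.Parity.GeneralizedHardyLittlewood.Theorems.MomentsBeyondDiagonal.DiagLines

/-- **The remainder identity.** For `0 < y₁ ≤ y₂ ≤ 1`: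
`(c_ab(y₁) − c_ab(y₂)) − (Π_ab(y₁) − Π_ab(y₂)) = ∫_{y₁<η≤y₂} (ηI_ab(η) − m_ab(η)) dη/η`.
[cite: KowalskiMichelVanderKam2000, (22)–(28) — derivation (remainder of the diagonal weight)] -/
theorem bose_coeff_sub_polyPart_sub_eq {y₁ y₂ : ℝ} (hy₁ : 0 < y₁) (h12 : y₁ ≤ y₂) (hy₂ : y₂ ≤ 1) (a b : ℕ) :
    ((∫ u₁ in Ioi (0 : ℝ), Real.log u₁ ^ a *
        ∫ u₂ in Ioi (y₁ / u₁), Real.exp (-(u₁ + u₂)) / (1 - Real.exp (-(u₁ + u₂))) ^ 2 * Real.log u₂ ^ b) -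
      (∫ u₁ in Ioi (0 : ℝ), Real.log u₁ ^ a *
        ∫ u₂ in Ioi (y₂ / u₁), Real.exp (-(u₁ + u₂)) / (1 - Real.exp (-(u₁ + u₂))) ^ 2 * Real.log u₂ ^ b)) -
      ((∑ i ∈ Finset.range (a + 1), ∑ j ∈ Finset.range (b + 1),
        (a.choose i : ℝ) * (b.choose j : ℝ) * ((-1) ^ j + (-1) ^ i) *
          (∫ v in Ioc (0 : ℝ) 1, Real.log v ^ (i + j) * (v / (1 + v ^ 2) ^ 2)) *
          ((-1 / 2 : ℝ) ^ (a - i + (b - j)) * Real.log (1 / y₁) ^ (a - i + (b - j) + 1) /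
            (((a - i + (b - j) : ℕ) : ℝ) + 1))) -
      ∑ i ∈ Finset.range (a + 1), ∑ j ∈ Finset.range (b + 1),
        (a.choose i : ℝ) * (b.choose j : ℝ) * ((-1) ^ j + (-1) ^ i) *
          (∫ v in Ioc (0 : ℝ) 1, Real.log v ^ (i + j) * (v / (1 + v ^ 2) ^ 2)) *
          ((-1 / 2 : ℝ) ^ (a - i + (b - j)) * Real.log (1 / y₂) ^ (a - i + (b - j) + 1) /
            (((a - i + (b - j) : ℕ) : ℝ) + 1))) =
      ∫ η in Ioc y₁ y₂, (η * (∫ u in Ioi (0 : ℝ), Real.log u ^ a * Real.log (η / u) ^ b *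
        (Real.exp (-(u + η / u)) / (1 - Real.exp (-(u + η / u))) ^ 2) / u) -
      ∫ v in Ioc (0 : ℝ) 1, ((-(Real.log (1 / η) / 2) + Real.log v) ^ a * (-(Real.log (1 / η) / 2) - Real.log v) ^ b +
          (-(Real.log (1 / η) / 2) - Real.log v) ^ a * (-(Real.log (1 / η) / 2) + Real.log v) ^ b) *
        (v / (1 + v ^ 2) ^ 2)) / η := by
  -- notation
  set I : ℝ → ℝ := fun η ↦ ∫ u in Ioi (0 : ℝ), Real.log u ^ a * Real.log (η / u) ^ b *
      (Real.exp (-(u + η / u)) / (1 - Real.exp (-(u + η / u))) ^ 2) / u with hI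
  set m : ℝ → ℝ := fun η ↦ ∫ v in Ioc (0 : ℝ) 1, ((-(Real.log (1 / η) / 2) + Real.log v) ^ a *
      (-(Real.log (1 / η) / 2) - Real.log v) ^ b +
        (-(Real.log (1 / η) / 2) - Real.log v) ^ a * (-(Real.log (1 / η) / 2) + Real.log v) ^ b) *
      (v / (1 + v ^ 2) ^ 2) with hm
  set μ : ℕ → ℝ := fun k ↦ ∫ v in Ioc (0 : ℝ) 1, Real.log v ^ k * (v / (1 + v ^ 2) ^ 2) with hμ
  have hy₂0 : 0 < y₂ := hy₁.trans_le h12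
  have hshell := bose_coeff_sub_eq_integral_shell hy₁ h12 a b
  -- integrability of `I` on `(y₁, y₂]`
  have hI_int : IntegrableOn I (Ioc y₁ y₂) := by
    have hG := (integrable_shellGuard (y₂ := y₂) hy₁ a b).integral_prod_right
    have hG0 : IntegrableOn (fun η : ℝ ↦ ∫ u in Ioi (0 : ℝ), (uncurry fun u η : ℝ ↦
        if 0 < u ∧ 0 < η ∧ y₁ < η ∧ η ≤ y₂ then Real.log u ^ a * Real.log (η / u) ^ b *
          (Real.exp (-(u + η / u)) / (1 - Real.exp (-(u + η / u))) ^ 2) / u else 0) (u, η)) (Set.Ioi (0 : ℝ)) := hG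
    have hsub : Set.Ioc y₁ y₂ ⊆ Set.Ioi (0 : ℝ) := fun η hη ↦ hy₁.trans hη.1
    refine (hG0.mono_set hsub).congr_fun (fun η hη ↦ ?_) measurableSet_Ioc
    have hη0 : 0 < η := hy₁.trans hη.1
    simp only [hI, uncurry]
    refine setIntegral_congr_fun measurableSet_Ioi fun u hu ↦ ?_
    rw [if_pos ⟨hu, hη0, hη.1, hη.2⟩]
  have hrem : IntegrableOn (fun η ↦ (η * I η - m η) / η) (Ioc y₁ y₂) :=
    (integrableOn_shell_rem a b).mono_set fun η hη ↦ ⟨hy₁.trans hη.1, hη.2.trans hy₂⟩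
  have hm_int : IntegrableOn (fun η ↦ m η / η) (Ioc y₁ y₂) := by
    refine (hI_int.sub hrem).congr_fun (fun η hη ↦ ?_) measurableSet_Ioc
    have hη0 : (0 : ℝ) < η := hy₁.trans hη.1
    show I η - (η * I η - m η) / η = m η / η
    field_simp
    ring
  have hsplit : ∫ η in Ioc y₁ y₂, I η = (∫ η in Ioc y₁ y₂, m η / η) + ∫ η in Ioc y₁ y₂, (η * I η - m η) / η := by
    rw [← integral_add hm_int hrem]
    refine setIntegral_congr_fun measurableSet_Ioc fun η hη ↦ ?_
    have hη0 : (0 : ℝ) < η := hy₁.trans hη.1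
    field_simp
    ring
  -- the polynomial part
  have hpoly : ∫ η in Ioc y₁ y₂, m η / η = (∑ i ∈ Finset.range (a + 1), ∑ j ∈ Finset.range (b + 1),
      (a.choose i : ℝ) * (b.choose j : ℝ) * ((-1) ^ j + (-1) ^ i) * μ (i + j) *
        ((-1 / 2 : ℝ) ^ (a - i + (b - j)) * Real.log (1 / y₁) ^ (a - i + (b - j) + 1) /
          (((a - i + (b - j) : ℕ) : ℝ) + 1))) -
      ∑ i ∈ Finset.range (a + 1), ∑ j ∈ Finset.range (b + 1),
      (a.choose i : ℝ) * (b.choose j : ℝ) * ((-1) ^ j + (-1) ^ i) * μ (i + j) *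
        ((-1 / 2 : ℝ) ^ (a - i + (b - j)) * Real.log (1 / y₂) ^ (a - i + (b - j) + 1) /
          (((a - i + (b - j) : ℕ) : ℝ) + 1)) := by
    have hptw : ∀ η ∈ Ioc y₁ y₂, m η / η = ∑ i ∈ Finset.range (a + 1), ∑ j ∈ Finset.range (b + 1),
        ((a.choose i : ℝ) * (b.choose j : ℝ) * ((-1) ^ j + (-1) ^ i) * μ (i + j) * (-1 / 2 : ℝ) ^ (a - i + (b - j))) *
          (Real.log (1 / η) ^ (a - i + (b - j)) / η) := by
      intro η hη
      simp only [hm, hμ]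
      rw [shell_model_expand, Finset.sum_div]
      refine Finset.sum_congr rfl fun i _ ↦ ?_
      rw [Finset.sum_div]
      refine Finset.sum_congr rfl fun j _ ↦ ?_
      rw [show -(Real.log (1 / η) / 2) = (-1 / 2 : ℝ) * Real.log (1 / η) by ring, mul_pow, mul_pow, pow_add,
        pow_add]
      ring
    have hterm_int : ∀ p : ℕ, IntegrableOn (fun η : ℝ ↦ Real.log (1 / η) ^ p / η) (Ioc y₁ y₂) := by
      intro p
      refine (ContinuousOn.integrableOn_Icc ?_).mono_set Ioc_subset_Icc_self
      refine ContinuousOn.div ?_ continuousOn_id fun η hη ↦ ne_of_gt (hy₁.trans_le hη.1)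
      refine ContinuousOn.pow (continuousOn_log.comp ?_ ?_) p
      · exact continuousOn_const.div continuousOn_id fun η hη ↦ ne_of_gt (hy₁.trans_le hη.1)
      · intro η hη
        simp only [Set.mem_compl_iff, Set.mem_singleton_iff]
        exact one_div_ne_zero (ne_of_gt (hy₁.trans_le hη.1))
    rw [setIntegral_congr_fun measurableSet_Ioc hptw,
      integral_finsetSum _ fun i _ ↦ integrable_finsetSum _ fun j _ ↦ (hterm_int _).const_mul _,
      ← Finset.sum_sub_distrib]
    refine Finset.sum_congr rfl fun i _ ↦ ?_
    rw [integral_finsetSum _ fun j _ ↦ (hterm_int _).const_mul _, ← Finset.sum_sub_distrib]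
    refine Finset.sum_congr rfl fun j _ ↦ ?_
    rw [integral_const_mul, integral_log_inv_pow_div _ hy₁ h12]
    push_cast
    ring
  -- assemble
  simp only [hI, hm, hμ] at hshell hsplit hpoly ⊢
  rw [hshell, hsplit, hpoly]
  ring

/-- **`|r_ab(y)| ≤ C√y` on `(0,1]`** for the continued remainder `r_ab(y) = c_ab(y) − (c_ab(1) + A_ab + Π_ab(y))`.
[cite: KowalskiMichelVanderKam2000, (22)–(28) — derivation (remainder of the diagonal weight)] -/
theorem abs_bose_rem_small_le_sqrt (a b : ℕ) : ∃ C : ℝ, ∀ y : ℝ, 0 < y → y ≤ 1 →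
    |(∫ u₁ in Ioi (0 : ℝ), Real.log u₁ ^ a *
        ∫ u₂ in Ioi (y / u₁), Real.exp (-(u₁ + u₂)) / (1 - Real.exp (-(u₁ + u₂))) ^ 2 * Real.log u₂ ^ b) -
      ((∫ u₁ in Ioi (0 : ℝ), Real.log u₁ ^ a *
          ∫ u₂ in Ioi (1 / u₁), Real.exp (-(u₁ + u₂)) / (1 - Real.exp (-(u₁ + u₂))) ^ 2 * Real.log u₂ ^ b) +
        (∫ η in Ioc (0 : ℝ) 1, (η * (∫ u in Ioi (0 : ℝ), Real.log u ^ a * Real.log (η / u) ^ b *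
            (Real.exp (-(u + η / u)) / (1 - Real.exp (-(u + η / u))) ^ 2) / u) -
          ∫ v in Ioc (0 : ℝ) 1, ((-(Real.log (1 / η) / 2) + Real.log v) ^ a * (-(Real.log (1 / η) / 2) - Real.log v) ^ b +
              (-(Real.log (1 / η) / 2) - Real.log v) ^ a * (-(Real.log (1 / η) / 2) + Real.log v) ^ b) *
            (v / (1 + v ^ 2) ^ 2)) / η) +
        ∑ i ∈ Finset.range (a + 1), ∑ j ∈ Finset.range (b + 1),
          (a.choose i : ℝ) * (b.choose j : ℝ) * ((-1) ^ j + (-1) ^ i) *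
            (∫ v in Ioc (0 : ℝ) 1, Real.log v ^ (i + j) * (v / (1 + v ^ 2) ^ 2)) *
            ((-1 / 2 : ℝ) ^ (a - i + (b - j)) * Real.log (1 / y) ^ (a - i + (b - j) + 1) /
              (((a - i + (b - j) : ℕ) : ℝ) + 1)))| ≤ C * Real.sqrt y := by
  obtain ⟨C, hC⟩ := bose_coeff_structure a b
  have hC0 : 0 ≤ C := by
    have h := hC 1 one_pos le_rfl
    have : (0 : ℝ) ≤ C * 1 * (1 + Real.log (1 / 1)) ^ (a + b + 1) := (abs_nonneg _).trans h
    simpa using this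
  refine ⟨C * (2 ^ (a + b + 1) * (1 + (2 * ((a + b + 1 : ℕ) : ℝ)) ^ (a + b + 1))), fun y hy0 hy1 ↦ ?_⟩
  have h := hC y hy0 hy1
  have hs := sqrt_mul_one_add_log_pow_le (a + b + 1) hy0 hy1
  have hy : y = Real.sqrt y * Real.sqrt y := (Real.mul_self_sqrt hy0.le).symm
  calc _ ≤ C * y * (1 + Real.log (1 / y)) ^ (a + b + 1) := h
    _ = C * Real.sqrt y * (Real.sqrt y * (1 + Real.log (1 / y)) ^ (a + b + 1)) := by nth_rw 1 [hy]; ring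
    _ ≤ C * Real.sqrt y * (2 ^ (a + b + 1) * (1 + (2 * ((a + b + 1 : ℕ) : ℝ)) ^ (a + b + 1))) := by gcongr
    _ = _ := by ring

/-- **`|r_ab(y₁) − r_ab(y₂)| ≤ C(y₂−y₁)/√y₁` for `0 < y₁ ≤ y₂ ≤ 1`** (the constant terms of `r_ab` cancel).
[cite: KowalskiMichelVanderKam2000, (22)–(28) — derivation (remainder of the diagonal weight)] -/
theorem abs_bose_rem_small_sub_le_sqrt (a b : ℕ) : ∃ C : ℝ, ∀ y₁ y₂ : ℝ, 0 < y₁ → y₁ ≤ y₂ → y₂ ≤ 1 →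
    |((∫ u₁ in Ioi (0 : ℝ), Real.log u₁ ^ a *
        ∫ u₂ in Ioi (y₁ / u₁), Real.exp (-(u₁ + u₂)) / (1 - Real.exp (-(u₁ + u₂))) ^ 2 * Real.log u₂ ^ b) -
      (∫ u₁ in Ioi (0 : ℝ), Real.log u₁ ^ a *
        ∫ u₂ in Ioi (y₂ / u₁), Real.exp (-(u₁ + u₂)) / (1 - Real.exp (-(u₁ + u₂))) ^ 2 * Real.log u₂ ^ b)) -
      ((∑ i ∈ Finset.range (a + 1), ∑ j ∈ Finset.range (b + 1),
        (a.choose i : ℝ) * (b.choose j : ℝ) * ((-1) ^ j + (-1) ^ i) *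
          (∫ v in Ioc (0 : ℝ) 1, Real.log v ^ (i + j) * (v / (1 + v ^ 2) ^ 2)) *
          ((-1 / 2 : ℝ) ^ (a - i + (b - j)) * Real.log (1 / y₁) ^ (a - i + (b - j) + 1) /
            (((a - i + (b - j) : ℕ) : ℝ) + 1))) -
      ∑ i ∈ Finset.range (a + 1), ∑ j ∈ Finset.range (b + 1),
        (a.choose i : ℝ) * (b.choose j : ℝ) * ((-1) ^ j + (-1) ^ i) *
          (∫ v in Ioc (0 : ℝ) 1, Real.log v ^ (i + j) * (v / (1 + v ^ 2) ^ 2)) *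
          ((-1 / 2 : ℝ) ^ (a - i + (b - j)) * Real.log (1 / y₂) ^ (a - i + (b - j) + 1) /
            (((a - i + (b - j) : ℕ) : ℝ) + 1)))| ≤ C * (y₂ - y₁) / Real.sqrt y₁ := by
  obtain ⟨C₁, hC₁⟩ := abs_integral_shell_rem_le a b
  have hC₁0 : 0 ≤ C₁ := by
    have h := hC₁ (1 / 2) 1 (by norm_num) (by norm_num) le_rfl
    have h2 : (0 : ℝ) < (1 - 1 / 2) * (1 + Real.log (1 / (1 / 2))) ^ (a + b + 1) := by
      have : 0 ≤ Real.log (1 / (1 / 2)) := Real.log_nonneg (by norm_num)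
      positivity
    have h3 : 0 ≤ C₁ * ((1 - 1 / 2) * (1 + Real.log (1 / (1 / 2))) ^ (a + b + 1)) := by
      rw [← mul_assoc]; exact (abs_nonneg _).trans h
    exact nonneg_of_mul_nonneg_left h3 h2
  set c : ℝ := 2 ^ (a + b + 1) * (1 + (2 * ((a + b + 1 : ℕ) : ℝ)) ^ (a + b + 1)) with hc
  refine ⟨C₁ * c, fun y₁ y₂ hy₁ h12 hy₂ ↦ ?_⟩
  rw [bose_coeff_sub_polyPart_sub_eq hy₁ h12 hy₂ a b]
  have hmain := hC₁ y₁ y₂ hy₁ h12 hy₂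
  have hs := sqrt_mul_one_add_log_pow_le (a + b + 1) hy₁ (h12.trans hy₂)
  have hs0 : 0 < Real.sqrt y₁ := Real.sqrt_pos.2 hy₁
  rw [le_div_iff₀ hs0]
  calc _ ≤ C₁ * (y₂ - y₁) * (1 + Real.log (1 / y₁)) ^ (a + b + 1) * Real.sqrt y₁ :=
        mul_le_mul_of_nonneg_right hmain hs0.le
    _ = C₁ * (y₂ - y₁) * (Real.sqrt y₁ * (1 + Real.log (1 / y₁)) ^ (a + b + 1)) := by ring
    _ ≤ C₁ * (y₂ - y₁) * c := by
        apply mul_le_mul_of_nonneg_left hs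
        exact mul_nonneg hC₁0 (by linarith)
    _ = C₁ * c * (y₂ - y₁) := by ring

end Summit.Parity.GeneralizedHardyLittlewood.Theorems.MomentsBeyondDiagonal.DiagLines

end
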